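import Mathlib.LinearAlgebra.Dual.BaseChange
import Mathlib.LinearAlgebra.Dual.Lemmas
import Mathlib.LinearAlgebra.PiTensorProduct.Basic
import Mathlib.LinearAlgebra.TensorProduct.Tower
import Mathlib.LinearAlgebra.TensorPower.Basic
import Mathlib.RingTheory.TensorProduct.Basic
import Mathlib.Algebra.BigOperators.Finprod
import Literature.AlgebraicGeometry.Motives.HodgeStructure
import HarnessLib

-- provenance: harness21/H21/H21/Prelude/MotiveAbstract/HodgeTensor.lean @ 4d2e698 (interim HEAD d8f2665); M5 mechanical rewrite
/-!
# Tensor constructions on Hodge structures; Mumford–Tate and Hodge groups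
(trunk `MotiveAbstract`, item C6 `HodgeTensor`)

For pure `ℚ`-Hodge structures `H : HodgeStructure V n` (filtration form, see
`Literature.Prelude.MotiveAbstract.HodgeStructure`) we construct the standard tensor operations
(Deligne, *Hodge cycles on abelian varieties*, LNM 900, I §3; Deligne, *Théorie de Hodge II*,
1.1.6–1.1.12 and 2.1.13; Voisin, *Hodge Theory I*, §7.3.1; Peters–Steenbrink, *Mixed Hodge
Structures*, Ex. 2.2/2.3):

* `HodgeStructure.tateTwist H j : HodgeStructure V (n - 2 * j)` — the Tate twist `H(j)`,
  `F^p H(j) = F^{p+j} H`;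
* `HodgeStructure.dual H : HodgeStructure (Module.Dual ℚ V) (-n)` (for `V` finite-dimensional) —
  `F^p V^∨ = (F^{1-p} V)^⊥`;
* `HodgeStructure.tensor H₁ H₂ : HodgeStructure (V ⊗[ℚ] W) (n + m)` —
  `F^p (V ⊗ W) = Σ_{a+b=p} F^a V ⊗ F^b W`;
* `HodgeStructure.hom H₁ H₂ : HodgeStructure (V →ₗ[ℚ] W) (m - n)` (for `V` finite-dimensional) —
  `F^p Hom(V, W) = {f | f(F^a V) ⊆ F^{a+p} W ∀ a}`;
* `HodgeStructure.tensorPower H r : HodgeStructure (⨂[ℚ]^r V) (r * n)` (Mathlib's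
  `TensorPower`, i.e. `⨂[ℚ] _ : Fin r, V`);
* `hodgeTensorSpace V a b = V^{⊗a} ⊗ (V^∨)^{⊗b}` with its Hodge structure
  `HodgeStructure.tensorSpace H a b` of weight `(a - b) n`, and the natural action
  `tensorSpaceAct g` of `g ∈ GL(V)`;
* the **Hodge group** `HodgeStructure.hodgeGroup H` (stabiliser of all Hodge tensors of all
  types `(p,p)`) and the **Mumford–Tate group** `HodgeStructure.mumfordTateGroup H`
  (stabiliser of the weight-`0`, type-`(0,0)` Hodge tensors), as subgroups of `V ≃ₗ[ℚ] V`
  (Deligne, LNM 900, I Prop. 3.4; Moonen, *An introduction to Mumford–Tate groups*, §4,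
  Key Property 4.5).

## Design

* Complexifications are Mathlib's `ℂ ⊗[ℚ] -`. The comparison maps between the
  complexification of a construction and the construction on complexifications are
  Mathlib's `TensorProduct.AlgebraTensorModule.distribBaseChange`
  (`ℂ ⊗ (V ⊗ W) ≃ₗ[ℂ] (ℂ ⊗ V) ⊗[ℂ] (ℂ ⊗ W)`), `Module.Dual.baseChange` and
  `LinearMap.baseChangeHom` (lifted to `ℂ`-linear maps by `LinearMap.liftBaseChange`), and,
  for tensor powers (no base change for `PiTensorProduct` in Mathlib), the map
  `piTensorBaseChange : ℂ ⊗ (⨂[ℚ] V) →ₗ[ℂ] ⨂[ℂ] (ℂ ⊗ V)` built here from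
  `PiTensorProduct.lift`. Filtrations on constructions are pulled back (`Submodule.comap`)
  along these maps.
* In `tensor` and `tensorPower` the filtration is `⨆` over multi-indices with
  `p ≤ a + b` (resp. `p ≤ ∑ aᵢ`) rather than `= p`; this is the same subspace as soon as there
  is at least one factor (filtrations are decreasing) and makes `F` decreasing also for the
  empty tensor power `Fin 0` (where it gives the unit structure `ℚ(0)`).
* The opposedness / exhaustion / separation fields of `dual`, `tensor`, `hom`, `tensorPower`
  are discharged by named lemmas stated first (`isCompl_dualFiltration`, …); those whose proof
  needs the Hodge decomposition or base-change isomorphisms are vendored as named facts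
  (`def … : Prop`; they are standard: Deligne, Hodge II, 1.1.12) and bundled in the
  `Prop`-valued class `HodgeTensorFacts`, which the constructions `dual`, `tensor`, `hom`,
  `tensorPower` (hence `tensorSpace`, `hodgeGroup`, `mumfordTateGroup`) take as an instance
  hypothesis `[HodgeTensorFacts]`; consumers add `[HodgeTensorFacts.{u,u}]` to their variables.
* **Finite-dimensionality.** `dual` and `hom` (hence `tensorSpace`, `hodgeGroup`,
  `mumfordTateGroup`) assume `[Module.Finite ℚ V]`: for infinite-dimensional `V` the comparison
  maps `ℂ ⊗ V^∨ → (ℂ ⊗ V)^∨` and `ℂ ⊗ Hom(V, W) → Hom_ℂ(V_ℂ, W_ℂ)` are not surjective and the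
  pulled-back filtrations fail to be opposed (there are explicit weight-`1` counterexamples).
  This is the generality of Deligne, LNM 900, I §3. `tensor` and `tensorPower` need no
  finiteness. (The target `W` of `hom` may stay arbitrary.)
* Weights are adjusted along equalities of integers with `HodgeStructure.cast`.
* Mathlib has no Hodge structures, Mumford–Tate groups or Hodge groups (`rg` finds nothing).
  The groups defined here are the groups of `ℚ`-points of the stabiliser group schemes; for
  polarizable `H` these are `Hg(H)(ℚ)` and `MT(H)(ℚ)` (Deligne, LNM 900, I 3.4–3.5), in general
  they contain them.
-/

open scoped TensorProduct PiTensorProduct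

noncomputable section

namespace Literature.AlgebraicGeometry.Motives

universe u v

variable {V : Type u} [AddCommGroup V] [Module ℚ V]
variable {W : Type v} [AddCommGroup W] [Module ℚ W]

namespace HodgeStructure

variable {n m : ℤ}

/-! ### Transport of the weight and Tate twists -/

/-- Transport a Hodge structure along an equality of weights (same filtration). [folklore] -/
def cast (H : HodgeStructure V n) (h : n = m) : HodgeStructure V m where
  F := H.F
  antitone_F := H.antitone_F
  exists_F_eq_top := H.exists_F_eq_top
  exists_F_eq_bot := H.exists_F_eq_bot
  isCompl_F_complexConj p q hpq := H.isCompl_F_complexConj p q (by omega)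

/-- The filtration of a transported Hodge structure is unchanged. [folklore] -/
@[simp]
theorem cast_F (H : HodgeStructure V n) (h : n = m) (p : ℤ) : (H.cast h).F p = H.F p := rfl

/-- The **Tate twist** `H(j)` of a Hodge structure: same underlying space (informally
`V ⊗ ℚ(j)`), weight `n - 2j`, filtration `F^p H(j) = F^{p+j} H`
(Deligne, *Théorie de Hodge II*, 2.1.13–2.1.14; Peters–Steenbrink, Ex. 2.3). [folklore] -/
def tateTwist (H : HodgeStructure V n) (j : ℤ) : HodgeStructure V (n - 2 * j) where
  F p := H.F (p + j)
  antitone_F _ _ h := H.antitone_F (by omega)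
  exists_F_eq_top := by
    obtain ⟨p, hp⟩ := H.exists_F_eq_top
    exact ⟨p - j, by simpa using hp⟩
  exists_F_eq_bot := by
    obtain ⟨p, hp⟩ := H.exists_F_eq_bot
    exact ⟨p - j, by simpa using hp⟩
  isCompl_F_complexConj p q hpq := H.isCompl_F_complexConj (p + j) (q + j) (by omega)

/-- The filtration of the Tate twist. [folklore] -/
@[simp]
theorem tateTwist_F (H : HodgeStructure V n) (j p : ℤ) : (H.tateTwist j).F p = H.F (p + j) :=
  rfl

/-! ### Duals -/

variable (V) in
/-- The comparison map `ℂ ⊗ V^∨ → (ℂ ⊗ V)^∨`, `c ⊗ φ ↦ (d ⊗ v ↦ c d φ(v))`, i.e. Mathlib's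
`Module.Dual.baseChange` made `ℂ`-linear by `LinearMap.liftBaseChange`. It is injective, and
bijective for `V` finite-dimensional (`IsBaseChange.dual`). [folklore] -/
def dualBaseChange : ℂ ⊗[ℚ] Module.Dual ℚ V →ₗ[ℂ] Module.Dual ℂ (ℂ ⊗[ℚ] V) :=
  (Module.Dual.baseChange ℂ : Module.Dual ℚ V →ₗ[ℚ] Module.Dual ℂ (ℂ ⊗[ℚ] V)).liftBaseChange ℂ

/-- `dualBaseChange (c ⊗ φ) (d ⊗ v) = φ v • (c d)`. [folklore] -/
@[simp]
theorem dualBaseChange_tmul_tmul (c d : ℂ) (φ : Module.Dual ℚ V) (v : V) :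
    dualBaseChange V (c ⊗ₜ[ℚ] φ) (d ⊗ₜ[ℚ] v) = c * (φ v • d) := by
  simp [dualBaseChange]

/-- The Hodge filtration on the dual: `F^p V^∨ := (F^{1-p} V)^⊥`, the forms whose
complexification kills `F^{1-p}` (Deligne, Hodge II, 1.1.6–1.1.7; Peters–Steenbrink, Ex. 2.2). [folklore] -/
def dualFiltration (H : HodgeStructure V n) (p : ℤ) : Submodule ℂ (ℂ ⊗[ℚ] Module.Dual ℚ V) :=
  (H.F (1 - p)).dualAnnihilator.comap (dualBaseChange V)

/-- Membership in the dual filtration. [folklore] -/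
theorem mem_dualFiltration_iff (H : HodgeStructure V n) (p : ℤ) (ξ : ℂ ⊗[ℚ] Module.Dual ℚ V) :
    ξ ∈ H.dualFiltration p ↔ ∀ x ∈ H.F (1 - p), dualBaseChange V ξ x = 0 := by
  simp [dualFiltration, Submodule.mem_dualAnnihilator]

/-- The dual filtration is decreasing. [folklore] -/
theorem antitone_dualFiltration (H : HodgeStructure V n) : Antitone H.dualFiltration :=
  fun _ _ h => Submodule.comap_mono (Submodule.dualAnnihilator_anti (H.antitone_F (by omega)))

/-- The dual filtration is exhaustive: if `F^{1-p} V = 0` then `F^p V^∨ = V^∨_ℂ`. [folklore] -/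
theorem exists_dualFiltration_eq_top (H : HodgeStructure V n) : ∃ p, H.dualFiltration p = ⊤ := by
  obtain ⟨q, hq⟩ := H.exists_F_eq_bot
  refine ⟨1 - q, ?_⟩
  rw [dualFiltration, show 1 - (1 - q) = q by ring, hq, Submodule.dualAnnihilator_bot,
    Submodule.comap_top]

/-- The dual filtration is separated: if `F^{1-p} V = V_ℂ` then `F^p V^∨ = 0`.
Relies on: injectivity of `dualBaseChange` (`ℂ` free over `ℚ`). [cite: DeligneHodgeII1971, 1.1.6–1.1.7] -/
def exists_dualFiltration_eq_bot : Prop :=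
  ∀ (H : HodgeStructure V n),
    ∃ p, H.dualFiltration p = ⊥

/-- The dual filtration is `(-n)`-opposed to its conjugate
(Deligne, Hodge II, 1.1.7 and 1.2.5: `(V^∨)^{p,q} = (V^{-p,-q})^∨`), for `V`
finite-dimensional (false in general: `dualBaseChange` need not be surjective).
Relies on: `Module.Finite ℚ V` (so that `dualBaseChange` is bijective, `IsBaseChange.dual`) and
the Hodge decomposition `iSup_piece_eq_top`, `iSupIndep_piece` of `H`. [cite: DeligneHodgeII1971, 1.1.7 and 1.2.5] -/
def isCompl_dualFiltration : Prop :=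
  ∀ [Module.Finite ℚ V] (H : HodgeStructure V n) (p q : ℤ), p + q = -n + 1 →
    IsCompl (H.dualFiltration p) (complexConj (H.dualFiltration q))

/-! ### Tensor products -/

variable (V W) in
/-- The reassociation `ℂ ⊗ (V ⊗ W) ≃ₗ[ℂ] (ℂ ⊗ V) ⊗[ℂ] (ℂ ⊗ W)` (Mathlib's
`TensorProduct.AlgebraTensorModule.distribBaseChange`). [folklore] -/
def tensorBaseChange : ℂ ⊗[ℚ] (V ⊗[ℚ] W) ≃ₗ[ℂ] (ℂ ⊗[ℚ] V) ⊗[ℂ] (ℂ ⊗[ℚ] W) :=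
  TensorProduct.AlgebraTensorModule.distribBaseChange ℚ ℂ V W

/-- `tensorBaseChange (c ⊗ (v ⊗ w)) = (c ⊗ v) ⊗ (1 ⊗ w)`. [folklore] -/
@[simp]
theorem tensorBaseChange_tmul (c : ℂ) (v : V) (w : W) :
    tensorBaseChange V W (c ⊗ₜ[ℚ] (v ⊗ₜ[ℚ] w)) = (c ⊗ₜ[ℚ] v) ⊗ₜ[ℂ] ((1 : ℂ) ⊗ₜ[ℚ] w) :=
  rfl

/-- The Hodge filtration on a tensor product: `F^p (V ⊗ W) := Σ_{p ≤ a + b} F^a V ⊗ F^b W`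
(Deligne, Hodge II, 1.1.12; Peters–Steenbrink, Ex. 2.2), pulled back to `ℂ ⊗ (V ⊗ W)` along
`tensorBaseChange`. [folklore] -/
def tensorFiltration (H₁ : HodgeStructure V n) (H₂ : HodgeStructure W m) (p : ℤ) :
    Submodule ℂ (ℂ ⊗[ℚ] (V ⊗[ℚ] W)) :=
  ⨆ (a : ℤ) (b : ℤ) (_ : p ≤ a + b),
    (LinearMap.range (TensorProduct.mapIncl (H₁.F a) (H₂.F b))).comap
      (tensorBaseChange V W : ℂ ⊗[ℚ] (V ⊗[ℚ] W) →ₗ[ℂ] _)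

/-- The tensor filtration is decreasing. [folklore] -/
theorem antitone_tensorFiltration (H₁ : HodgeStructure V n) (H₂ : HodgeStructure W m) :
    Antitone (H₁.tensorFiltration H₂) :=
  fun _ _ h => iSup₂_mono fun _ _ => iSup_mono' fun hab => ⟨h.trans hab, le_rfl⟩

/-- The tensor filtration is exhaustive.
Relies on: exhaustion of `H₁.F`, `H₂.F` (and `TensorProduct.map_surjective`). [folklore] -/
theorem exists_tensorFiltration_eq_top (H₁ : HodgeStructure V n) (H₂ : HodgeStructure W m) :
    ∃ p, H₁.tensorFiltration H₂ p = ⊤ := by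
  obtain ⟨a, ha⟩ := H₁.exists_F_eq_top
  obtain ⟨b, hb⟩ := H₂.exists_F_eq_top
  refine ⟨a + b, eq_top_iff.2 ?_⟩
  refine le_trans ?_ (le_iSup₂_of_le a b (le_iSup_of_le le_rfl le_rfl))
  have hr : LinearMap.range (TensorProduct.mapIncl (H₁.F a) (H₂.F b)) = ⊤ := by
    rw [LinearMap.range_eq_top]
    apply TensorProduct.map_surjective
    · rw [← LinearMap.range_eq_top, Submodule.range_subtype, ha]
    · rw [← LinearMap.range_eq_top, Submodule.range_subtype, hb]
  rw [hr, Submodule.comap_top]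

/-- The tensor filtration is separated.
Relies on: separation and finiteness of `H₁.F`, `H₂.F` (flatness of subspaces over `ℂ`). [cite: DeligneHodgeII1971, 1.1.12] -/
def exists_tensorFiltration_eq_bot : Prop :=
  ∀ (H₁ : HodgeStructure V n) (H₂ : HodgeStructure W m),
    ∃ p, H₁.tensorFiltration H₂ p = ⊥

/-- The tensor filtration is `(n + m)`-opposed to its conjugate, with
`(V ⊗ W)^{p,q} = ⊕ V^{a,b} ⊗ W^{p-a,q-b}` (Deligne, Hodge II, 1.1.12 and 1.2.5).
Relies on: the Hodge decompositions of `H₁` and `H₂`. [cite: DeligneHodgeII1971, 1.1.12 and 1.2.5] -/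
def isCompl_tensorFiltration : Prop :=
  ∀ (H₁ : HodgeStructure V n) (H₂ : HodgeStructure W m) (p q : ℤ), p + q = n + m + 1 →
    IsCompl (H₁.tensorFiltration H₂ p) (complexConj (H₁.tensorFiltration H₂ q))

/-! ### Internal Hom -/

variable (V W) in
/-- The comparison map `ℂ ⊗ Hom(V, W) → Hom_ℂ(ℂ ⊗ V, ℂ ⊗ W)`, `c ⊗ f ↦ c • f_ℂ`
(Mathlib's `LinearMap.baseChangeHom` made `ℂ`-linear by `LinearMap.liftBaseChange`). [folklore] -/
def homBaseChange : ℂ ⊗[ℚ] (V →ₗ[ℚ] W) →ₗ[ℂ] (ℂ ⊗[ℚ] V →ₗ[ℂ] ℂ ⊗[ℚ] W) :=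
  (LinearMap.baseChangeHom ℚ ℂ V W).liftBaseChange ℂ

/-- `homBaseChange (c ⊗ f) = c • f_ℂ`. [folklore] -/
@[simp]
theorem homBaseChange_tmul (c : ℂ) (f : V →ₗ[ℚ] W) :
    homBaseChange V W (c ⊗ₜ[ℚ] f) = c • f.baseChange ℂ := by
  simp [homBaseChange]

/-- The Hodge filtration on `Hom(V, W)`:
`F^p Hom(V, W) := {f | f(F^a V) ⊆ F^{a+p} W for all a}` (Deligne, Hodge II, 1.1.6, 1.1.12;
Peters–Steenbrink, Ex. 2.2), on `ℂ ⊗ Hom(V, W)` via `homBaseChange`. [folklore] -/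
def homFiltration (H₁ : HodgeStructure V n) (H₂ : HodgeStructure W m) (p : ℤ) :
    Submodule ℂ (ℂ ⊗[ℚ] (V →ₗ[ℚ] W)) where
  carrier := {ξ | ∀ a, ∀ x ∈ H₁.F a, homBaseChange V W ξ x ∈ H₂.F (a + p)}
  zero_mem' a x _ := by simp
  add_mem' {ξ η} hξ hη a x hx := by
    simpa using (H₂.F (a + p)).add_mem (hξ a x hx) (hη a x hx)
  smul_mem' c {ξ} hξ a x hx := by
    simpa using (H₂.F (a + p)).smul_mem c (hξ a x hx)

/-- Membership in the Hom filtration. [folklore] -/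
theorem mem_homFiltration_iff (H₁ : HodgeStructure V n) (H₂ : HodgeStructure W m) (p : ℤ)
    (ξ : ℂ ⊗[ℚ] (V →ₗ[ℚ] W)) :
    ξ ∈ H₁.homFiltration H₂ p ↔ ∀ a, ∀ x ∈ H₁.F a, homBaseChange V W ξ x ∈ H₂.F (a + p) :=
  Iff.rfl

/-- The Hom filtration is decreasing. [folklore] -/
theorem antitone_homFiltration (H₁ : HodgeStructure V n) (H₂ : HodgeStructure W m) :
    Antitone (H₁.homFiltration H₂) :=
  fun _ _ h _ hξ a x hx => H₂.antitone_F (by omega) (hξ a x hx)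

/-- The Hom filtration is exhaustive: if `F^{b₁} V = 0` and `F^{t₂} W = W_ℂ` then
`F^{t₂ - b₁} Hom(V, W)` is everything. Relies on: finiteness of `H₁.F`, `H₂.F` only. [folklore] -/
theorem exists_homFiltration_eq_top (H₁ : HodgeStructure V n) (H₂ : HodgeStructure W m) :
    ∃ p, H₁.homFiltration H₂ p = ⊤ := by
  obtain ⟨b₁, hb₁⟩ := H₁.exists_F_eq_bot
  obtain ⟨t₂, ht₂⟩ := H₂.exists_F_eq_top
  refine ⟨t₂ - b₁, eq_top_iff.2 fun ξ _ a x hx => ?_⟩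
  by_cases ha : b₁ ≤ a
  · have hx0 : x ∈ H₁.F b₁ := H₁.antitone_F ha hx
    rw [hb₁, Submodule.mem_bot] at hx0
    simp [hx0]
  · have hle : a + (t₂ - b₁) ≤ t₂ := by omega
    exact H₂.antitone_F hle (by simp [ht₂])

/-- The Hom filtration is separated.
Relies on: finiteness of `H₁.F`, `H₂.F` and injectivity of `homBaseChange`. [cite: DeligneHodgeII1971, 1.1.6 and 1.1.12] -/
def exists_homFiltration_eq_bot : Prop :=
  ∀ (H₁ : HodgeStructure V n) (H₂ : HodgeStructure W m),
    ∃ p, H₁.homFiltration H₂ p = ⊥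

/-- The Hom filtration is `(m - n)`-opposed to its conjugate, with
`Hom(V, W)^{p,q} = ⊕ Hom(V^{a,b}, W^{a+p,b+q})` (Deligne, Hodge II, 1.1.12, 1.2.5), for `V`
finite-dimensional (false in general: `homBaseChange` need not be surjective; `W` may be
arbitrary since `ℂ ⊗ Hom(V, W) ≅ Hom_ℂ(V_ℂ, W_ℂ)` for `V` finitely presented).
Relies on: `Module.Finite ℚ V` and the Hodge decompositions of `H₁` and `H₂`. [cite: DeligneHodgeII1971, 1.1.12 and 1.2.5] -/
def isCompl_homFiltration : Prop :=
  ∀ [Module.Finite ℚ V] (H₁ : HodgeStructure V n) (H₂ : HodgeStructure W m) (p q : ℤ),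
    p + q = m - n + 1 → IsCompl (H₁.homFiltration H₂ p) (complexConj (H₁.homFiltration H₂ q))

/-! ### Tensor powers -/

universe w in
variable (V) in
/-- The comparison map `ℂ ⊗ (⨂_i V) → ⨂_i (ℂ ⊗ V)` (over `ℂ`), `c ⊗ (⊗ vᵢ) ↦ c • ⊗ (1 ⊗ vᵢ)`,
built from `PiTensorProduct.lift` and `LinearMap.liftBaseChange` (Mathlib has no base change
for `PiTensorProduct` at the pinned commit). It is an isomorphism for finite index types. [folklore] -/
def piTensorBaseChange (ι : Type w) :
    ℂ ⊗[ℚ] (⨂[ℚ] _ : ι, V) →ₗ[ℂ] ⨂[ℂ] _ : ι, (ℂ ⊗[ℚ] V) :=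
  (PiTensorProduct.lift
    (((PiTensorProduct.tprod ℂ (s := fun _ : ι => ℂ ⊗[ℚ] V)).restrictScalars ℚ).compLinearMap
      fun _ => ofRat)).liftBaseChange ℂ

universe w in
/-- `piTensorBaseChange (c ⊗ ⨂ₜ vᵢ) = c • ⨂ₜ (1 ⊗ vᵢ)`. [folklore] -/
@[simp]
theorem piTensorBaseChange_tmul_tprod {ι : Type w} (c : ℂ) (v : ι → V) :
    piTensorBaseChange V ι (c ⊗ₜ[ℚ] PiTensorProduct.tprod ℚ v) =
      c • PiTensorProduct.tprod ℂ fun i => ofRat (v i) := by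
  simp [piTensorBaseChange]

/-- The Hodge filtration on a tensor power: `F^p (V^{⊗r}) := Σ_{p ≤ Σ aᵢ} ⊗ᵢ F^{aᵢ} V`
(Deligne, Hodge II, 1.1.12), pulled back to `ℂ ⊗ V^{⊗r}` along `piTensorBaseChange`. [folklore] -/
def tensorPowerFiltration (H : HodgeStructure V n) (r : ℕ) (p : ℤ) :
    Submodule ℂ (ℂ ⊗[ℚ] (⨂[ℚ] _ : Fin r, V)) :=
  ⨆ (a : Fin r → ℤ) (_ : p ≤ ∑ i, a i),
    (LinearMap.range (PiTensorProduct.mapIncl fun i => H.F (a i))).comap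
      (piTensorBaseChange V (Fin r))

/-- The tensor-power filtration is decreasing. [folklore] -/
theorem antitone_tensorPowerFiltration (H : HodgeStructure V n) (r : ℕ) :
    Antitone (H.tensorPowerFiltration r) :=
  fun _ _ h => iSup_mono fun _ => iSup_mono' fun ha => ⟨h.trans ha, le_rfl⟩

/-- The tensor-power filtration is exhaustive.
Relies on: exhaustion of `H.F` and surjectivity of `piTensorBaseChange` for `Fin r`. [cite: DeligneHodgeII1971, 1.1.12] -/
def exists_tensorPowerFiltration_eq_top : Prop :=
  ∀ (H : HodgeStructure V n) (r : ℕ),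
    ∃ p, H.tensorPowerFiltration r p = ⊤

/-- The tensor-power filtration is separated.
Relies on: finiteness of `H.F` and injectivity of `piTensorBaseChange`. [cite: DeligneHodgeII1971, 1.1.12] -/
def exists_tensorPowerFiltration_eq_bot : Prop :=
  ∀ (H : HodgeStructure V n) (r : ℕ),
    ∃ p, H.tensorPowerFiltration r p = ⊥

/-- The tensor-power filtration is `r n`-opposed to its conjugate
(Deligne, Hodge II, 1.1.12, 1.2.5).
Relies on: the Hodge decomposition of `H`. [cite: DeligneHodgeII1971, 1.1.12 and 1.2.5] -/
def isCompl_tensorPowerFiltration : Prop :=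
  ∀ (H : HodgeStructure V n) (r : ℕ) (p q : ℤ), p + q = r * n + 1 →
    IsCompl (H.tensorPowerFiltration r p) (complexConj (H.tensorPowerFiltration r q))

end HodgeStructure

/-! ### The constructions, under the standing named facts -/

/-- **Standing hypotheses of the tensor constructions.**  The separation / exhaustion /
opposedness properties of the Hodge filtrations on duals, tensor products, internal Homs and
tensor powers (Deligne, *Théorie de Hodge II*, 1.1.6–1.1.12 and 1.2.5) whose proofs need the
Hodge decomposition or base-change isomorphisms for `PiTensorProduct` are vendored above as
named facts (`HodgeStructure.exists_dualFiltration_eq_bot`, `HodgeStructure.isCompl_dualFiltration`,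
`HodgeStructure.exists_tensorFiltration_eq_bot`, `HodgeStructure.isCompl_tensorFiltration`,
`HodgeStructure.exists_homFiltration_eq_bot`, `HodgeStructure.isCompl_homFiltration`,
`HodgeStructure.exists_tensorPowerFiltration_eq_top`/`_eq_bot`,
`HodgeStructure.isCompl_tensorPowerFiltration`).  This `Prop`-valued class bundles them, for
all `ℚ`-spaces `V : Type u`, `W : Type v` and all weights, so that the constructions `dual`,
`tensor`, `hom`, `tensorPower` (hence `tensorSpace`, `hodgeGroup`, `mumfordTateGroup`) can take
them as the single instance hypothesis `[HodgeTensorFacts]`; single-space constructions use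
`HodgeTensorFacts.{u,u}`. [cite: DeligneHodgeII1971, 1.1.6–1.1.12] -/
class HodgeTensorFacts : Prop where
  /-- Separation of the dual filtration (`HodgeStructure.exists_dualFiltration_eq_bot`). -/
  exists_dualFiltration_eq_bot : ∀ {V : Type u} [AddCommGroup V] [Module ℚ V] {n : ℤ},
    HodgeStructure.exists_dualFiltration_eq_bot (V := V) (n := n)
  /-- Opposedness of the dual filtration (`HodgeStructure.isCompl_dualFiltration`). -/
  isCompl_dualFiltration : ∀ {V : Type u} [AddCommGroup V] [Module ℚ V] {n : ℤ},
    HodgeStructure.isCompl_dualFiltration (V := V) (n := n)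
  /-- Separation of the tensor filtration (`HodgeStructure.exists_tensorFiltration_eq_bot`). -/
  exists_tensorFiltration_eq_bot : ∀ {V : Type u} [AddCommGroup V] [Module ℚ V]
    {W : Type v} [AddCommGroup W] [Module ℚ W] {n m : ℤ},
    HodgeStructure.exists_tensorFiltration_eq_bot (V := V) (W := W) (n := n) (m := m)
  /-- Opposedness of the tensor filtration (`HodgeStructure.isCompl_tensorFiltration`). -/
  isCompl_tensorFiltration : ∀ {V : Type u} [AddCommGroup V] [Module ℚ V]
    {W : Type v} [AddCommGroup W] [Module ℚ W] {n m : ℤ},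
    HodgeStructure.isCompl_tensorFiltration (V := V) (W := W) (n := n) (m := m)
  /-- Separation of the Hom filtration (`HodgeStructure.exists_homFiltration_eq_bot`). -/
  exists_homFiltration_eq_bot : ∀ {V : Type u} [AddCommGroup V] [Module ℚ V]
    {W : Type v} [AddCommGroup W] [Module ℚ W] {n m : ℤ},
    HodgeStructure.exists_homFiltration_eq_bot (V := V) (W := W) (n := n) (m := m)
  /-- Opposedness of the Hom filtration (`HodgeStructure.isCompl_homFiltration`). -/
  isCompl_homFiltration : ∀ {V : Type u} [AddCommGroup V] [Module ℚ V]
    {W : Type v} [AddCommGroup W] [Module ℚ W] {n m : ℤ},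
    HodgeStructure.isCompl_homFiltration (V := V) (W := W) (n := n) (m := m)
  /-- Exhaustion of the tensor-power filtration
  (`HodgeStructure.exists_tensorPowerFiltration_eq_top`). -/
  exists_tensorPowerFiltration_eq_top : ∀ {V : Type u} [AddCommGroup V] [Module ℚ V] {n : ℤ},
    HodgeStructure.exists_tensorPowerFiltration_eq_top (V := V) (n := n)
  /-- Separation of the tensor-power filtration
  (`HodgeStructure.exists_tensorPowerFiltration_eq_bot`). -/
  exists_tensorPowerFiltration_eq_bot : ∀ {V : Type u} [AddCommGroup V] [Module ℚ V] {n : ℤ},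
    HodgeStructure.exists_tensorPowerFiltration_eq_bot (V := V) (n := n)
  /-- Opposedness of the tensor-power filtration
  (`HodgeStructure.isCompl_tensorPowerFiltration`). -/
  isCompl_tensorPowerFiltration : ∀ {V : Type u} [AddCommGroup V] [Module ℚ V] {n : ℤ},
    HodgeStructure.isCompl_tensorPowerFiltration (V := V) (n := n)

namespace HodgeStructure

variable {n m : ℤ}

/-- The **dual Hodge structure** `H^∨` on `Module.Dual ℚ V`, of weight `-n`, for `V`
finite-dimensional (Deligne, Hodge II, 1.1.6–1.1.7; Deligne, LNM 900, I §3; Peters–Steenbrink,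
Ex. 2.2); separation and opposedness from `[HodgeTensorFacts]`. [folklore] -/
def dual [HodgeTensorFacts.{u, u}] [Module.Finite ℚ V] (H : HodgeStructure V n) :
    HodgeStructure (Module.Dual ℚ V) (-n) where
  F := H.dualFiltration
  antitone_F := H.antitone_dualFiltration
  exists_F_eq_top := H.exists_dualFiltration_eq_top
  exists_F_eq_bot := HodgeTensorFacts.exists_dualFiltration_eq_bot.{u, u} H
  isCompl_F_complexConj := HodgeTensorFacts.isCompl_dualFiltration.{u, u} H

/-- The filtration of the dual. [folklore] -/
@[simp]
theorem dual_F [HodgeTensorFacts.{u, u}] [Module.Finite ℚ V] (H : HodgeStructure V n) (p : ℤ) :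
    H.dual.F p = H.dualFiltration p := rfl

/-- The **tensor product** `H₁ ⊗ H₂` of Hodge structures of weights `n` and `m`, of weight
`n + m` (Deligne, Hodge II, 1.1.12, 2.1; Deligne, LNM 900, I §3; Voisin I, §7.3.1); separation
and opposedness from `[HodgeTensorFacts]`. [folklore] -/
def tensor [HodgeTensorFacts.{u, v}] (H₁ : HodgeStructure V n) (H₂ : HodgeStructure W m) :
    HodgeStructure (V ⊗[ℚ] W) (n + m) where
  F := H₁.tensorFiltration H₂
  antitone_F := H₁.antitone_tensorFiltration H₂
  exists_F_eq_top := H₁.exists_tensorFiltration_eq_top H₂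
  exists_F_eq_bot := HodgeTensorFacts.exists_tensorFiltration_eq_bot H₁ H₂
  isCompl_F_complexConj := HodgeTensorFacts.isCompl_tensorFiltration H₁ H₂

/-- The filtration of the tensor product. [folklore] -/
@[simp]
theorem tensor_F [HodgeTensorFacts.{u, v}] (H₁ : HodgeStructure V n) (H₂ : HodgeStructure W m)
    (p : ℤ) : (H₁.tensor H₂).F p = H₁.tensorFiltration H₂ p := rfl

/-- The **internal Hom** `Hom(H₁, H₂)` of Hodge structures of weights `n` and `m` (with `V`
finite-dimensional): a Hodge structure of weight `m - n` on `V →ₗ[ℚ] W` (Deligne, Hodge II,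
1.1.6, 2.1; Deligne, LNM 900, I §3; Voisin I, §7.3.1); separation and opposedness from
`[HodgeTensorFacts]`. Its weight-`0` Hodge classes are the morphisms of Hodge structures
(`mem_hodgeClasses_hom_iff`). [folklore] -/
def hom [HodgeTensorFacts.{u, v}] [Module.Finite ℚ V] (H₁ : HodgeStructure V n)
    (H₂ : HodgeStructure W m) : HodgeStructure (V →ₗ[ℚ] W) (m - n) where
  F := H₁.homFiltration H₂
  antitone_F := H₁.antitone_homFiltration H₂
  exists_F_eq_top := H₁.exists_homFiltration_eq_top H₂
  exists_F_eq_bot := HodgeTensorFacts.exists_homFiltration_eq_bot H₁ H₂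
  isCompl_F_complexConj := HodgeTensorFacts.isCompl_homFiltration H₁ H₂

/-- The filtration of the internal Hom. [folklore] -/
@[simp]
theorem hom_F [HodgeTensorFacts.{u, v}] [Module.Finite ℚ V] (H₁ : HodgeStructure V n)
    (H₂ : HodgeStructure W m) (p : ℤ) : (H₁.hom H₂).F p = H₁.homFiltration H₂ p := rfl

/-- The **tensor power** `H^{⊗r}` of a Hodge structure of weight `n`: a Hodge structure of
weight `r n` on Mathlib's `TensorPower ℚ r V = ⨂[ℚ] (i : Fin r), V` (Deligne, LNM 900, I §3.1;
Hodge II, 1.1.12); exhaustion, separation and opposedness from `[HodgeTensorFacts]`. For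
`r = 0` this is the unit structure `ℚ(0)`. [folklore] -/
def tensorPower [HodgeTensorFacts.{u, u}] (H : HodgeStructure V n) (r : ℕ) :
    HodgeStructure (⨂[ℚ]^r V) (r * n) where
  F := H.tensorPowerFiltration r
  antitone_F := H.antitone_tensorPowerFiltration r
  exists_F_eq_top := HodgeTensorFacts.exists_tensorPowerFiltration_eq_top.{u, u} H r
  exists_F_eq_bot := HodgeTensorFacts.exists_tensorPowerFiltration_eq_bot.{u, u} H r
  isCompl_F_complexConj := HodgeTensorFacts.isCompl_tensorPowerFiltration.{u, u} H r

/-- The filtration of the tensor power. [folklore] -/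
@[simp]
theorem tensorPower_F [HodgeTensorFacts.{u, u}] (H : HodgeStructure V n) (r : ℕ) (p : ℤ) :
    (H.tensorPower r).F p = H.tensorPowerFiltration r p := rfl

/-! ### Hodge numbers and Hodge classes of the constructions -/

/-- Hodge numbers of a tensor product: `h^{p,q}(H₁ ⊗ H₂) = Σ_{a,b} h^{a,b}(H₁) h^{p-a,q-b}(H₂)`
(Deligne, Hodge II, 1.1.12: `(V ⊗ W)^{p,q} = ⊕ V^{a,b} ⊗ W^{p-a,q-b}`). [cite: DeligneHodgeII1971, 1.1.12] -/
def hodgeNumber_tensor : Prop :=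
  ∀ [HodgeTensorFacts.{u, v}] [Module.Finite ℚ V] [Module.Finite ℚ W] (H₁ : HodgeStructure V n)
    (H₂ : HodgeStructure W m) (p q : ℤ),
    (H₁.tensor H₂).hodgeNumber p q =
      ∑ᶠ (a : ℤ) (b : ℤ), H₁.hodgeNumber a b * H₂.hodgeNumber (p - a) (q - b)

/-- The weight-`0` Hodge classes of `Hom(H₁, H₂)` (for `H₁`, `H₂` of the same weight) are
exactly the morphisms of Hodge structures: `f ∈ F^0 Hom ∩ Hom_ℚ` iff `f_ℂ (F^p) ⊆ F^p` for
all `p` (Deligne, Hodge II, 1.1.6 and 2.1; Voisin I, Lemma 7.25 / §11.1). (The same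
equivalence, with the same proof, holds for `hodgeClasses 0` of `hom` in any two weights; equal
weights is what makes these the morphisms of Hodge structures.) [folklore] -/
theorem mem_hodgeClasses_hom_iff [HodgeTensorFacts.{u, v}] [Module.Finite ℚ V] (H₁ : HodgeStructure V n)
    (H₂ : HodgeStructure W n) (f : V →ₗ[ℚ] W) :
    f ∈ (H₁.hom H₂).hodgeClasses 0 ↔ ∀ p, (H₁.F p).map (f.baseChange ℂ) ≤ H₂.F p := by
  simp only [mem_hodgeClasses_iff, hom_F, mem_homFiltration_iff, ofRat_apply,
    homBaseChange_tmul, one_smul, add_zero, Submodule.map_le_iff_le_comap]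
  rfl

end HodgeStructure

/-! ### Tensor spaces and the Mumford–Tate and Hodge groups -/

variable (V) in
/-- The tensor space `T^{a,b} V := V^{⊗a} ⊗ (V^∨)^{⊗b}` (Deligne, LNM 900, I §3.1), with
Mathlib's `TensorPower` (`⨂[ℚ]^a V = ⨂[ℚ] _ : Fin a, V`). [folklore] -/
abbrev hodgeTensorSpace (a b : ℕ) : Type u :=
  (⨂[ℚ]^a V) ⊗[ℚ] (⨂[ℚ]^b (Module.Dual ℚ V))

/-- The Hodge structure `T^{a,b} H := H^{⊗a} ⊗ (H^∨)^{⊗b}` on `hodgeTensorSpace V a b`, of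
weight `(a - b) n`, for `V` finite-dimensional (Deligne, LNM 900, I §3.1). [folklore] -/
def HodgeStructure.tensorSpace [HodgeTensorFacts.{u, u}] [Module.Finite ℚ V] {n : ℤ}
    (H : HodgeStructure V n) (a b : ℕ) :
    HodgeStructure (hodgeTensorSpace V a b) (((a : ℤ) - b) * n) :=
  ((H.tensorPower a).tensor (H.dual.tensorPower b)).cast (by ring)

/-- The natural action of `g ∈ GL(V)` on `T^{a,b} V`: `g^{⊗a} ⊗ ((g^{-1})^∨)^{⊗b}`
(Deligne, LNM 900, I §3.1), via `PiTensorProduct.congr` and `LinearEquiv.dualMap`. [folklore] -/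
def tensorSpaceAct {a b : ℕ} (g : V ≃ₗ[ℚ] V) :
    hodgeTensorSpace V a b ≃ₗ[ℚ] hodgeTensorSpace V a b :=
  TensorProduct.congr (PiTensorProduct.congr fun _ => g)
    (PiTensorProduct.congr fun _ => g.symm.dualMap)

/-- `tensorSpaceAct g` on pure tensors. [folklore] -/
@[simp]
theorem tensorSpaceAct_tmul_tprod {a b : ℕ} (g : V ≃ₗ[ℚ] V) (v : Fin a → V)
    (φ : Fin b → Module.Dual ℚ V) :
    tensorSpaceAct g (PiTensorProduct.tprod ℚ v ⊗ₜ[ℚ] PiTensorProduct.tprod ℚ φ) =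
      (PiTensorProduct.tprod ℚ fun i => g (v i)) ⊗ₜ[ℚ]
        PiTensorProduct.tprod ℚ fun i => (φ i).comp (g.symm : V →ₗ[ℚ] V) := by
  simp [tensorSpaceAct]
  rfl

/-- `tensorSpaceAct g` as a linear map is `TensorProduct.map` of `PiTensorProduct.map`s. [folklore] -/
theorem coe_tensorSpaceAct {a b : ℕ} (g : V ≃ₗ[ℚ] V) :
    (tensorSpaceAct (a := a) (b := b) g : hodgeTensorSpace V a b →ₗ[ℚ] hodgeTensorSpace V a b) =
      TensorProduct.map (PiTensorProduct.map fun _ => (g : V →ₗ[ℚ] V))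
        (PiTensorProduct.map fun _ => (g.symm.dualMap : Module.Dual ℚ V →ₗ[ℚ] _)) :=
  rfl

/-- The identity acts trivially on `T^{a,b} V`. [folklore] -/
@[simp]
theorem tensorSpaceAct_one {a b : ℕ} : tensorSpaceAct (a := a) (b := b) (1 : V ≃ₗ[ℚ] V) = 1 := by
  apply LinearEquiv.toLinearMap_injective
  rw [coe_tensorSpaceAct]
  have h₁ : ((1 : V ≃ₗ[ℚ] V) : V →ₗ[ℚ] V) = LinearMap.id := rfl
  have h₂ : ((1 : V ≃ₗ[ℚ] V).symm.dualMap : Module.Dual ℚ V →ₗ[ℚ] Module.Dual ℚ V) =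
      LinearMap.id := rfl
  simp only [h₁, h₂, PiTensorProduct.map_id, TensorProduct.map_id]
  rfl

/-- The action on `T^{a,b} V` is multiplicative. [folklore] -/
theorem tensorSpaceAct_mul {a b : ℕ} (g h : V ≃ₗ[ℚ] V) :
    tensorSpaceAct (a := a) (b := b) (g * h) = tensorSpaceAct g * tensorSpaceAct h := by
  apply LinearEquiv.toLinearMap_injective
  rw [LinearEquiv.mul_eq_trans, LinearEquiv.mul_eq_trans, LinearEquiv.coe_trans,
    coe_tensorSpaceAct, coe_tensorSpaceAct, coe_tensorSpaceAct, ← TensorProduct.map_comp,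
    ← PiTensorProduct.map_comp, ← PiTensorProduct.map_comp]
  rfl

/-- `tensorSpaceAct (g * h) t = tensorSpaceAct g (tensorSpaceAct h t)`. [folklore] -/
theorem tensorSpaceAct_mul_apply {a b : ℕ} (g h : V ≃ₗ[ℚ] V) (t : hodgeTensorSpace V a b) :
    tensorSpaceAct (g * h) t = tensorSpaceAct g (tensorSpaceAct h t) := by
  rw [tensorSpaceAct_mul]; rfl

namespace HodgeStructure

variable {n : ℤ}

/-- The subgroup of `GL(V)` fixing a family of tensors `S a b ⊆ T^{a,b} V`. [folklore] -/
def tensorStabilizer (S : ∀ a b : ℕ, Set (hodgeTensorSpace V a b)) :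
    Subgroup (V ≃ₗ[ℚ] V) where
  carrier := {g | ∀ a b, ∀ t ∈ S a b, tensorSpaceAct g t = t}
  one_mem' a b t _ := by simp
  mul_mem' {g h} hg hh a b t ht := by rw [tensorSpaceAct_mul_apply, hh a b t ht, hg a b t ht]
  inv_mem' {g} hg a b t ht := by
    apply (tensorSpaceAct (a := a) (b := b) g).injective
    rw [← tensorSpaceAct_mul_apply, mul_inv_cancel, tensorSpaceAct_one, hg a b t ht]
    rfl

/-- Membership in a tensor stabiliser. [folklore] -/
theorem mem_tensorStabilizer_iff (S : ∀ a b : ℕ, Set (hodgeTensorSpace V a b))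
    (g : V ≃ₗ[ℚ] V) : g ∈ tensorStabilizer S ↔ ∀ a b, ∀ t ∈ S a b, tensorSpaceAct g t = t :=
  Iff.rfl

/-- Tensor stabilisers are antitone in the family of tensors. [folklore] -/
theorem tensorStabilizer_anti {S T : ∀ a b : ℕ, Set (hodgeTensorSpace V a b)}
    (h : ∀ a b, S a b ⊆ T a b) : tensorStabilizer T ≤ tensorStabilizer S :=
  fun _ hg a b t ht => hg a b t (h a b ht)

variable [HodgeTensorFacts.{u, u}] [Module.Finite ℚ V]

/-- The **Hodge group** `Hg(H)` (ℚ-points): the subgroup of `GL(V)` fixing every Hodge tensor,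
i.e. every rational tensor `t ∈ T^{a,b} V` of type `(p,p)`, `(a - b) n = 2p`
(Deligne, LNM 900, I Prop. 3.4 and Rem. 3.5 applied to `h|U(1)`; Moonen, *An introduction to
Mumford–Tate groups*, §4, Key Property 4.5 and §5). For polarizable `H` this is the group of
`ℚ`-points of the Hodge group (the smallest `ℚ`-subgroup of `GL(V)` containing `h(U(1))`);
in general it contains it. [folklore] -/
def hodgeGroup (H : HodgeStructure V n) : Subgroup (V ≃ₗ[ℚ] V) :=
  tensorStabilizer fun a b =>
    {t | ∃ p : ℤ, ((a : ℤ) - b) * n = 2 * p ∧ t ∈ (H.tensorSpace a b).hodgeClasses p}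

/-- Membership in the Hodge group: `g` fixes all Hodge tensors of all types `(p,p)`. [folklore] -/
theorem mem_hodgeGroup_iff (H : HodgeStructure V n) (g : V ≃ₗ[ℚ] V) :
    g ∈ H.hodgeGroup ↔ ∀ (a b : ℕ) (p : ℤ), ((a : ℤ) - b) * n = 2 * p →
      ∀ t ∈ (H.tensorSpace a b).hodgeClasses p, tensorSpaceAct g t = t := by
  refine ⟨fun hg a b p hp t ht => hg a b t ⟨p, hp, ht⟩, fun hg a b t ht => ?_⟩
  obtain ⟨p, hp, ht⟩ := ht
  exact hg a b p hp t ht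

/-- The **Mumford–Tate group** `MT(H)` (ℚ-points): the subgroup of `GL(V)` fixing every
rational tensor `t ∈ T^{a,b} V` of weight `0` (`(a - b) n = 0`) and type `(0,0)`
(Deligne, LNM 900, I Prop. 3.4; Moonen, *An introduction to Mumford–Tate groups*, §4, Key
Property 4.5). For polarizable `H` this is the group of `ℚ`-points of the Mumford–Tate group
(the smallest `ℚ`-subgroup of `GL(V)` containing `h(𝕊)`); in general it contains it. One has
`MT = 𝔾ₘ · Hg` for `n ≠ 0` and `MT = Hg` for `n = 0`
(`mumfordTateGroup_eq_hodgeGroup_of_weight_zero`). [folklore] -/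
def mumfordTateGroup (H : HodgeStructure V n) : Subgroup (V ≃ₗ[ℚ] V) :=
  tensorStabilizer fun a b => {t | ((a : ℤ) - b) * n = 0 ∧ t ∈ (H.tensorSpace a b).hodgeClasses 0}

/-- Membership in the Mumford–Tate group: `g` fixes all weight-`0` Hodge tensors of type
`(0,0)`. [folklore] -/
theorem mem_mumfordTateGroup_iff (H : HodgeStructure V n) (g : V ≃ₗ[ℚ] V) :
    g ∈ H.mumfordTateGroup ↔ ∀ a b : ℕ, ((a : ℤ) - b) * n = 0 →
      ∀ t ∈ (H.tensorSpace a b).hodgeClasses 0, tensorSpaceAct g t = t :=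
  ⟨fun hg a b hab t ht => hg a b t ⟨hab, ht⟩, fun hg a b t ht => hg a b ht.1 t ht.2⟩

/-- `Hg(H) ⊆ MT(H)` (Deligne, LNM 900, I 3.4–3.5; Moonen §4): fixing all Hodge tensors in
particular fixes those of type `(0,0)`. [folklore] -/
theorem hodgeGroup_le_mumfordTateGroup (H : HodgeStructure V n) :
    H.hodgeGroup ≤ H.mumfordTateGroup :=
  tensorStabilizer_anti fun _ _ _ ht => ⟨0, by simpa using ht.1, ht.2⟩

/-- In weight `0`, `MT(H) = Hg(H)` (Moonen §4; Deligne, LNM 900, I 3.4): the condition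
`(a - b) · 0 = 2p` forces `p = 0`. [folklore] -/
theorem mumfordTateGroup_eq_hodgeGroup_of_weight_zero (H : HodgeStructure V 0) :
    H.mumfordTateGroup = H.hodgeGroup := by
  refine le_antisymm (tensorStabilizer_anti fun a b t ht => ?_) H.hodgeGroup_le_mumfordTateGroup
  obtain ⟨p, hp, ht⟩ := ht
  obtain rfl : p = 0 := by omega
  exact ⟨by simp, ht⟩

/-- Homotheties lie in the Mumford–Tate group when `n ≠ 0`: `c • id` acts on `T^{a,b}` by
`c^{a-b}`, which is `1` on the weight-`0` spaces `a = b` (Deligne, LNM 900, I 3.4: `MT(H)`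
contains `h(𝔾ₘ) = ` homotheties for `n ≠ 0`). [cite: Deligne1982HodgeCycles, I 3.4] -/
def homothety_mem_mumfordTateGroup : Prop :=
  ∀ (H : HodgeStructure V n), n ≠ 0 → ∀ c : ℚˣ, LinearEquiv.smulOfUnit c ∈ H.mumfordTateGroup

/-- Sanity check: the Hodge group of `ℚ(j)` is trivial for every `j` — `T^{1,0} = ℚ(j)` consists
of Hodge classes of type `(-j,-j)`, moved by every `g ≠ 1` (Moonen §5, Example: `Hg(ℚ(1)) = 1`).
No hypothesis `j ≠ 0` is needed (for `j = 0` the type is `(0,0)`). [cite: Moonen2004MT, §5] -/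
def hodgeGroup_tate : Prop :=
  ∀ [HodgeTensorFacts.{0, 0}] (j : ℤ), (tate j).hodgeGroup = ⊥

/-- Sanity check: for `j ≠ 0` the Mumford–Tate group (ℚ-points) of `ℚ(j)` is all of
`GL₁(ℚ) = ℚˣ` — the weight-`0` tensor spaces are the `T^{a,a}`, on which `g` acts by
`g^a (g^{-1})^a = 1` (Deligne, LNM 900, I 3.4: `MT(ℚ(1)) = 𝔾ₘ`). For `j = 0` this is false:
`MT(ℚ(0)) = Hg(ℚ(0)) = 1` by `mumfordTateGroup_eq_hodgeGroup_of_weight_zero` and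
`hodgeGroup_tate`. [cite: Deligne1982HodgeCycles, I 3.4] -/
def mumfordTateGroup_tate : Prop :=
  ∀ [HodgeTensorFacts.{0, 0}] {j : ℤ}, j ≠ 0 → (tate j).mumfordTateGroup = ⊤

omit [HodgeTensorFacts.{u, u}] in
/-- Sanity check: `MT(ℚ(0)) = 1` (the Mumford–Tate group of the unit object is trivial), given
the named fact `hodgeGroup_tate` (hypothesis `h`). [folklore] -/
theorem mumfordTateGroup_tate_zero [HodgeTensorFacts.{0, 0}] (h : hodgeGroup_tate) :
    (tate 0).mumfordTateGroup = ⊥ :=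
  (mumfordTateGroup_eq_hodgeGroup_of_weight_zero (V := ℚ) (tate 0)).trans (h 0)

end HodgeStructure

end Literature.AlgebraicGeometry.Motives

end
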